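import Mathlib.GroupTheory.Abelianization.Defs
import Mathlib.GroupTheory.Commutator.Basic
import Mathlib.GroupTheory.GroupAction.ConjAct
import Mathlib.GroupTheory.QuotientGroup.Defs
import Mathlib.RepresentationTheory.Basic
import Mathlib.Algebra.Group.Units.Equiv
import Mathlib.Algebra.MonoidAlgebra.MapDomain
import Mathlib.Algebra.Polynomial.Laurent
import Mathlib.RingTheory.Ideal.Maps
import Mathlib.RingTheory.Ideal.Span
import Mathlib.LinearAlgebra.Matrix.Determinant.Basic
import Mathlib.LinearAlgebra.Matrix.Adjugate
import Mathlib.RingTheory.Ideal.Quotient.Basic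
import Mathlib.Algebra.Module.Torsion.Basic
import HarnessLib

-- provenance: harness21/H21/H21/Prelude/FourManM/AlexanderModule.lean @ c47457c (interim HEAD d8f2665); M5 mechanical rewrite
/-!
# The Alexander module and Alexander polynomial of a group (trunk T-4MAN, item C10)

This file is the purely algebraic half of the notion `alexander_polynomial` of the outline
`H21/Outlines/FourManM.md` (§C10, Design 2). No topology appears here; the knot-theoretic
wrapper (`Knot.IsAlexanderPolynomial`) lives in the `KnotGroup` item.

## Informal content

Let `G` be a group with commutator subgroup `G' = commutator G` and abelianization
`Gᵃᵇ = G ⧸ G'`. Conjugation of `G` on the normal subgroup `G'` descends to an action of `Gᵃᵇ` on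
`(G')ᵃᵇ = G'/G''`, because inner automorphisms of `G'` act trivially on `(G')ᵃᵇ`. This makes the
abelian group `G'/G''` a module over the integral group ring `ℤ[Gᵃᵇ]`: the *Alexander module* of `G`.
Its order ideal (the `0`-th Fitting ideal, a.k.a. `0`-th elementary ideal) is the *Alexander ideal*.
When `Gᵃᵇ ≃ ℤ` (e.g. `G` a knot group), `ℤ[Gᵃᵇ] ≃ ℤ[t, t⁻¹]` and any generator `Δ` of the (then
principal) Alexander ideal is *an Alexander polynomial* of `G`; it is well defined up to units `±tᵏ`
and up to `t ↦ t⁻¹` (choice of the isomorphism `Gᵃᵇ ≃ ℤ`). Both ambiguities are absorbed by the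
predicate `Literature.IsAlexanderPolynomial G Δ`.

## Main definitions

* `Literature.Module.fittingIdeal R A`: the `0`-th Fitting ideal of an `R`-module `A`, the ideal generated by
  the determinants of all square relation matrices of finite generating families of `A`.
* `Literature.MulAut.abelianizationMap H : MulAut H →* MulAut (Abelianization H)`: functoriality of
  abelianization on automorphisms.
* `Literature.conjAbelianization G : G →* MulAut (Abelianization (commutator G))`,
  `Literature.conjRep G : Abelianization G →* MulAut (Abelianization (commutator G))`: the conjugation
  action and its descent to `Gᵃᵇ`.
* `Literature.alexanderRep G : Representation ℤ (Abelianization G) (Additive (Abelianization (commutator G)))`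
  and `Literature.alexanderModule G := (alexanderRep G).asModule`, a `MonoidAlgebra ℤ (Abelianization G)`-module
  (Mathlib's `Representation.asModule` instance).
* `Literature.alexanderIdeal G`: the `0`-th Fitting ideal of the Alexander module.
* `Literature.laurentEquivOfMulEquiv e : MonoidAlgebra ℤ (Abelianization G) ≃+* LaurentPolynomial ℤ` for
  `e : Abelianization G ≃* Multiplicative ℤ`.
* `Literature.IsAlexanderPolynomial G Δ`: `Δ` generates the image of the Alexander ideal under some such `e`.

## Sources

R. H. Crowell, R. H. Fox, *Introduction to Knot Theory* (1963), Ch. VII–VIII (elementary ideals,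
Alexander matrices, knot polynomials); D. Rolfsen, *Knots and Links* (1976), §7.B–7.D;
D. Eisenbud, *Commutative Algebra*, §20.2 (Fitting ideals).

## Design choices / Mathlib

* Mathlib has no Fitting ideals (grep `Fitting` only hits Lie-algebra Fitting decompositions), no
  Alexander module/polynomial. It has everything else used here: `commutator`, `Abelianization`,
  `MulAut.conjNormal`, `MulEquiv.abelianizationCongr`, `QuotientGroup.lift`, `Representation.asModule`,
  `MonoidAlgebra.mapDomainRingEquiv`, `AddMonoidAlgebra.toMultiplicative`, `LaurentPolynomial.invert`.
* `Module.fittingIdeal` is stated with `Fin n`-indexed generating families so that membership is a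
  first-order condition; for a module that is not finitely generated it is `⊥` (no generating family).
* `alexanderModule` is an `abbrev` for `(alexanderRep G).asModule`, so the `AddCommGroup` and
  `Module (MonoidAlgebra ℤ (Abelianization G))` instances are Mathlib's, not new ones.
* The names `Literature.Topology.FourManifolds.Module.fittingIdeal` and `Literature.Topology.FourManifolds.MulAut.abelianizationMap` live in sub-namespaces of
  `Literature` mirroring the Mathlib namespaces they would belong to (`Module`, `MulAut`); they do not touch
  Mathlib's own namespaces.
-/

noncomputable section

open scoped LaurentPolynomial

namespace Literature.Topology.FourManifolds

/-! ## The `0`-th Fitting ideal -/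

section Fitting

variable (R : Type*) [CommRing R] (A : Type*) [AddCommGroup A] [Module R A]

/-- The `0`-th **Fitting ideal** (order ideal, `0`-th elementary ideal) of the `R`-module `A`: the ideal
of `R` generated by all determinants `det a` of square matrices `a ∈ Mₙ(R)` of relations
`∑ⱼ aᵢⱼ • xⱼ = 0` among a finite generating family `x : Fin n → A` of `A`. Equivalently (Eisenbud,
*Commutative Algebra* §20.2; Crowell–Fox 1963 Ch. VII §4) the ideal generated by the `n × n` minors of
any presentation matrix of `A` with `n` generators; the present intrinsic form avoids choosing a
presentation. If `A` is not finitely generated this is `⊥`. Absent from Mathlib. [cite: CrowellFox1963, Ch. VII §4] -/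
def Module.fittingIdeal : Ideal R :=
  Ideal.span {d | ∃ (n : ℕ) (x : Fin n → A) (a : Matrix (Fin n) (Fin n) R),
    Submodule.span R (Set.range x) = ⊤ ∧ (∀ i, ∑ j, a i j • x j = 0) ∧ d = a.det}

/-- The Fitting ideal of the zero module is the unit ideal (take the empty generating family and the
empty relation matrix, whose determinant is `1`). Eisenbud §20.2. [folklore] -/
theorem Module.fittingIdeal_eq_top_of_subsingleton [Subsingleton A] :
    Module.fittingIdeal R A = ⊤ := by
  rw [Module.fittingIdeal, Ideal.eq_top_iff_one]
  refine Ideal.subset_span ⟨0, Fin.elim0, 0, ?_, fun i => Fin.elim0 i, ?_⟩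
  · exact Subsingleton.elim _ _
  · exact (Matrix.det_isEmpty).symm

/-- The Fitting ideal of a cyclic module `R ⧸ (r)` is `(r)` (Eisenbud, *Commutative Algebra*,
discussion after Cor. 20.4; Crowell–Fox Ch. VII (4.5)). [cite: Eisenbud1995, §20.2 (discussion after Cor. 20.4)] -/
def Module.fittingIdeal_quotient_span_singleton : Prop :=
  ∀ (r : R),
    Module.fittingIdeal R (R ⧸ Ideal.span {r}) = Ideal.span {r}

/-- The Fitting ideal annihilates the module: `Fitt₀(A) ≤ Ann(A)` (Eisenbud Prop. 20.7; by the
adjugate identity `adj(a) a = det(a) • 1`). No finiteness hypothesis is needed with our definition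
(the ideal is `⊥` when `A` is not finitely generated). [cite: Eisenbud1995, Prop. 20.7] -/
def Module.fittingIdeal_le_annihilator : Prop :=
  Module.fittingIdeal R A ≤ Module.annihilator R A

end Fitting

/-! ## The conjugation action of `Gᵃᵇ` on `G'/G''` -/

section Group

variable (G : Type*) [Group G]

/-- Functoriality of abelianization on automorphisms: the monoid hom `Aut(H) → Aut(Hᵃᵇ)`,
`e ↦ e.abelianizationCongr` (Mathlib `MulEquiv.abelianizationCongr`, packaged as a `MonoidHom`). [folklore] -/
def MulAut.abelianizationMap (H : Type*) [Group H] : MulAut H →* MulAut (Abelianization H) where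
  toFun e := e.abelianizationCongr
  map_one' := abelianizationCongr_refl
  map_mul' e f := (abelianizationCongr_trans f e).symm

/-- `MulAut.abelianizationMap` acts on generators by the underlying automorphism. [folklore] -/
@[simp]
theorem MulAut.abelianizationMap_apply_of {H : Type*} [Group H] (e : MulAut H) (h : H) :
    MulAut.abelianizationMap H e (Abelianization.of h) = Abelianization.of (e h) := rfl

/-- The action of `G` on `(G')ᵃᵇ = G'/G''` induced by conjugation on the normal subgroup
`G' = commutator G` (Crowell–Fox 1963 Ch. VIII §3; Rolfsen 7.B): the composition of Mathlib's
`MulAut.conjNormal : G →* MulAut (commutator G)` with `MulAut.abelianizationMap`. [cite: CrowellFox1963, Ch. VIII §3] -/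
def conjAbelianization : G →* MulAut (Abelianization (commutator G)) :=
  (MulAut.abelianizationMap (commutator G)).comp MulAut.conjNormal

/-- `conjAbelianization G g` acts on the class of `h ∈ G'` as the class of `g h g⁻¹`. [folklore] -/
@[simp]
theorem conjAbelianization_apply_of (g : G) (h : commutator G) :
    conjAbelianization G g (Abelianization.of h) = Abelianization.of (MulAut.conjNormal g h) := rfl

/-- Elements of the commutator subgroup act trivially on `G'/G''`: they act on `G'` by inner
automorphisms, which become trivial on the abelianization. This is the kernel condition allowing the
conjugation action to descend to `Gᵃᵇ` (Crowell–Fox Ch. VIII §3). [folklore] -/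
theorem commutator_le_ker_conjAbelianization :
    commutator G ≤ (conjAbelianization G).ker := by
  intro g hg
  rw [MonoidHom.mem_ker]
  obtain ⟨g, rfl⟩ : ∃ g' : commutator G, (g' : G) = g := ⟨⟨g, hg⟩, rfl⟩
  ext x
  induction x using QuotientGroup.induction_on with
  | H h =>
    change Abelianization.of (MulAut.conjNormal (g : G) h) = Abelianization.of h
    rw [MulAut.conjNormal_val, MulAut.conj_apply, map_mul, map_mul, map_inv, mul_inv_cancel_comm]

/-- The conjugation representation of the abelianization `Gᵃᵇ` on `G'/G''` by group automorphisms,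
obtained by descending `conjAbelianization G` along `G → Gᵃᵇ = G ⧸ G'` (`QuotientGroup.lift`, kernel
condition `commutator_le_ker_conjAbelianization`). Crowell–Fox 1963 Ch. VIII §3; Rolfsen 7.B. [cite: CrowellFox1963, Ch. VIII §3] -/
def conjRep : Abelianization G →* MulAut (Abelianization (commutator G)) :=
  QuotientGroup.lift (commutator G) (conjAbelianization G) (commutator_le_ker_conjAbelianization G)

/-- `conjRep` on the class of `g : G` is conjugation by `g`. [folklore] -/
@[simp]
theorem conjRep_of (g : G) : conjRep G (Abelianization.of g) = conjAbelianization G g := rfl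

/-- The **Alexander representation**: `Gᵃᵇ` acting `ℤ`-linearly on the additive group
`Additive (G'/G'')` by conjugation (`conjRep`, transported along `Additive` and made `ℤ`-linear).
Crowell–Fox 1963 Ch. VIII §3; Rolfsen 7.B. [cite: CrowellFox1963, Ch. VIII §3] -/
def alexanderRep : Representation ℤ (Abelianization G) (Additive (Abelianization (commutator G))) where
  toFun a := ((MulEquiv.toAdditive (conjRep G a) : Additive (Abelianization (commutator G)) →+
    Additive (Abelianization (commutator G)))).toIntLinearMap
  map_one' := by ext x; simp
  map_mul' a b := by ext x; simp

/-- Unfolding `alexanderRep` to `conjRep` through `Additive`. [folklore] -/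
@[simp]
theorem alexanderRep_apply (a : Abelianization G) (x : Additive (Abelianization (commutator G))) :
    alexanderRep G a x = Additive.ofMul (conjRep G a x.toMul) := rfl

/-- The Alexander representation on generators: the class of `g` sends the class of `h ∈ G'` to the
class of `g h g⁻¹` (Crowell–Fox Ch. VIII §3). [folklore] -/
theorem alexanderRep_of_apply_ofMul_of (g : G) (h : commutator G) :
    alexanderRep G (Abelianization.of g) (Additive.ofMul (Abelianization.of h)) =
      Additive.ofMul (Abelianization.of (MulAut.conjNormal g h)) := rfl

/-- The **Alexander module** of a group `G`: the abelian group `G'/G''` regarded as a module over the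
integral group ring `ℤ[Gᵃᵇ] = MonoidAlgebra ℤ (Abelianization G)` via the conjugation action
(`alexanderRep`). Implemented as Mathlib's `Representation.asModule`, whence the `AddCommGroup` and
`Module (MonoidAlgebra ℤ (Abelianization G))` instances. Crowell–Fox 1963 Ch. VIII; Rolfsen 7.B–7.C. [cite: CrowellFox1963, Ch. VIII] -/
abbrev alexanderModule : Type _ := (alexanderRep G).asModule

example : Module (MonoidAlgebra ℤ (Abelianization G)) (alexanderModule G) := inferInstance

/-- The **Alexander ideal** of `G`: the `0`-th Fitting (order / first elementary) ideal of the Alexander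
module, an ideal of `ℤ[Gᵃᵇ]` (Crowell–Fox 1963 Ch. VIII (3.3); Rolfsen 7.C). [cite: CrowellFox1963, Ch. VIII (3.3] -/
def alexanderIdeal : Ideal (MonoidAlgebra ℤ (Abelianization G)) :=
  Module.fittingIdeal (MonoidAlgebra ℤ (Abelianization G)) (alexanderModule G)

/-- The Alexander ideal is the unit ideal when the Alexander module vanishes. [folklore] -/
theorem alexanderIdeal_eq_top_of_subsingleton [Subsingleton (alexanderModule G)] :
    alexanderIdeal G = ⊤ :=
  Module.fittingIdeal_eq_top_of_subsingleton _ _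

/-- An isomorphism `e : Gᵃᵇ ≃* ℤ` (written multiplicatively) identifies the group ring `ℤ[Gᵃᵇ]` with the
Laurent polynomial ring `ℤ[t, t⁻¹] = AddMonoidAlgebra ℤ ℤ`: compose Mathlib's
`MonoidAlgebra.mapDomainRingEquiv ℤ e` with the inverse of `AddMonoidAlgebra.toMultiplicative ℤ ℤ`.
(Rolfsen 7.B: `t` is the image of a meridian.) [folklore] -/
def laurentEquivOfMulEquiv (e : Abelianization G ≃* Multiplicative ℤ) :
    MonoidAlgebra ℤ (Abelianization G) ≃+* ℤ[T;T⁻¹] :=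
  (MonoidAlgebra.mapDomainRingEquiv ℤ e).trans (AddMonoidAlgebra.toMultiplicative ℤ ℤ).symm

/-- `laurentEquivOfMulEquiv e` sends the group-ring element `r·a` to `r t^{e a}`. [folklore] -/
@[simp]
theorem laurentEquivOfMulEquiv_single (e : Abelianization G ≃* Multiplicative ℤ)
    (a : Abelianization G) (r : ℤ) :
    laurentEquivOfMulEquiv G e (MonoidAlgebra.single a r) =
      LaurentPolynomial.C r * LaurentPolynomial.T (e a).toAdd := by
  rw [← LaurentPolynomial.single_eq_C_mul_T, laurentEquivOfMulEquiv, RingEquiv.trans_apply,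
    MonoidAlgebra.mapDomainRingEquiv_single, RingEquiv.symm_apply_eq]
  change _ = MonoidAlgebra.ofCoeff (Finsupp.mapDomain _ (AddMonoidAlgebra.single _ _).coeff)
  rw [AddMonoidAlgebra.coeff_single, Finsupp.mapDomain_single]
  rfl

/-- Following `e : Gᵃᵇ ≃* ℤ` by inversion `n ↦ -n` on `ℤ` composes the identification
`ℤ[Gᵃᵇ] ≃+* ℤ[t, t⁻¹]` with the involution `t ↦ t⁻¹` (`LaurentPolynomial.invert`). [folklore] -/
theorem laurentEquivOfMulEquiv_trans_inv (e : Abelianization G ≃* Multiplicative ℤ) :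
    laurentEquivOfMulEquiv G (e.trans (MulEquiv.inv _)) =
      (laurentEquivOfMulEquiv G e).trans LaurentPolynomial.invert.toRingEquiv := by
  apply RingEquiv.toRingHom_injective
  apply MonoidAlgebra.ringHom_ext
  · intro r; simp [laurentEquivOfMulEquiv_single]
  · intro a; simp [laurentEquivOfMulEquiv_single]

/-- `Δ ∈ ℤ[t, t⁻¹]` **is an Alexander polynomial of the group `G`**: for some isomorphism
`e : Gᵃᵇ ≃* ℤ`, the image of the Alexander ideal of `G` in `ℤ[t, t⁻¹]` is the principal ideal `(Δ)`.
The two classical ambiguities — multiplication by units `±tᵏ` and the substitution `t ↦ t⁻¹` — are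
absorbed by `Ideal.span` and by the existential over `e` respectively (see
`IsAlexanderPolynomial.mul_isUnit`, `IsAlexanderPolynomial.invert`). If `Gᵃᵇ ≄ ℤ` no `Δ` qualifies.
Crowell–Fox 1963 Ch. VIII (3.5); Rolfsen 7.C Def. 2. [cite: CrowellFox1963, Ch. VIII (3.5] -/
def IsAlexanderPolynomial (Δ : ℤ[T;T⁻¹]) : Prop :=
  ∃ e : Abelianization G ≃* Multiplicative ℤ,
    (alexanderIdeal G).map (laurentEquivOfMulEquiv G e) = Ideal.span {Δ}

variable {G}

/-- Alexander polynomials are defined up to units of `ℤ[t, t⁻¹]` (i.e. `±tᵏ`): Crowell–Fox Ch. VIII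
(3.5). [folklore] -/
theorem IsAlexanderPolynomial.mul_isUnit {Δ u : ℤ[T;T⁻¹]} (h : IsAlexanderPolynomial G Δ)
    (hu : IsUnit u) : IsAlexanderPolynomial G (u * Δ) := by
  obtain ⟨e, he⟩ := h
  exact ⟨e, by rw [he, Ideal.span_singleton_mul_left_unit hu]⟩

/-- Alexander polynomials are defined up to `t ↦ t⁻¹` (replace `e` by `e` followed by inversion on
`ℤ`); Crowell–Fox Ch. VIII (3.5), Rolfsen 7.C. [folklore] -/
theorem IsAlexanderPolynomial.invert {Δ : ℤ[T;T⁻¹]} (h : IsAlexanderPolynomial G Δ) :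
    IsAlexanderPolynomial G (LaurentPolynomial.invert Δ) := by
  obtain ⟨e, he⟩ := h
  refine ⟨e.trans (MulEquiv.inv _), ?_⟩
  rw [laurentEquivOfMulEquiv_trans_inv, ← Ideal.map_coe, RingEquiv.coe_ringHom_trans,
    ← Ideal.map_map, Ideal.map_coe, Ideal.map_coe, he, Ideal.map_span, Set.image_singleton]
  rfl

variable (G) in
/-- If the Alexander module vanishes (and `Gᵃᵇ ≃ ℤ`), then `1` is an Alexander polynomial. [folklore] -/
theorem isAlexanderPolynomial_one_of_subsingleton [Subsingleton (alexanderModule G)]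
    (e : Abelianization G ≃* Multiplicative ℤ) : IsAlexanderPolynomial G 1 :=
  ⟨e, by rw [alexanderIdeal_eq_top_of_subsingleton, Ideal.map_top, Ideal.span_singleton_one]⟩

end Group

/-- The group `ℤ` (the group of the unknot) has Alexander polynomial `1`: its commutator subgroup is
trivial, so the Alexander module vanishes (Rolfsen 7.B Example 1). [folklore] -/
theorem isAlexanderPolynomial_int_one : IsAlexanderPolynomial (Multiplicative ℤ) 1 := by
  have : Subsingleton (commutator (Multiplicative ℤ)) := by
    rw [commutator_eq_bot]; infer_instance
  have : Subsingleton (alexanderModule (Multiplicative ℤ)) := ⟨fun a b => by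
    induction a using QuotientGroup.induction_on
    induction b using QuotientGroup.induction_on
    exact congrArg _ (Subsingleton.elim _ _)⟩
  exact isAlexanderPolynomial_one_of_subsingleton _ Abelianization.equivOfComm.symm

/-! ## Discharges: `Fitt₀ ≤ Ann` and `Fitt₀(R ⧸ (r)) = (r)` -/

section FittingProofs

variable (R : Type*) [CommRing R] (A : Type*) [AddCommGroup A] [Module R A]

/-- If `a` is a square matrix of relations among a family `x` (`∑ⱼ aᵢⱼ • xⱼ = 0` for all `i`), then
`det a` kills every `x k`: multiply by the adjugate, `adj(a) a = det(a) • 1` (Eisenbud, proof of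
Prop. 20.7). [cite: Eisenbud1995, Prop. 20.7] -/
theorem Module.det_smul_eq_zero_of_relations {n : Type*} [Fintype n] [DecidableEq n]
    (x : n → A) (a : Matrix n n R) (ha : ∀ i, ∑ j, a i j • x j = 0) (k : n) :
    a.det • x k = 0 := by
  have h2 : ∑ i, a.adjugate k i • (∑ j, a i j • x j) = 0 :=
    Finset.sum_eq_zero fun i _ => by rw [ha i, smul_zero]
  simp_rw [Finset.smul_sum, smul_smul] at h2
  rw [Finset.sum_comm] at h2
  simp_rw [← Finset.sum_smul] at h2
  have h3 : ∀ j, ∑ i, a.adjugate k i * a i j = (a.det • (1 : Matrix n n R)) k j := fun j => by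
    rw [← Matrix.adjugate_mul, Matrix.mul_apply]
  simp_rw [h3, Matrix.smul_apply, Matrix.one_apply, smul_eq_mul, mul_ite, mul_one, mul_zero,
    ite_smul, zero_smul, Finset.sum_ite_eq, Finset.mem_univ, if_true] at h2
  exact h2

/-- **Discharge** of `Module.fittingIdeal_le_annihilator`: `Fitt₀(A) ≤ Ann(A)` (Eisenbud Prop. 20.7).
Each generator `det a` of the Fitting ideal kills the generating family `x` by
`Module.det_smul_eq_zero_of_relations`, hence kills `A = span x`. [cite: Eisenbud1995, Prop. 20.7] -/
theorem Module.fittingIdeal_le_annihilator_holds : Module.fittingIdeal_le_annihilator R A := by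
  classical
  unfold Module.fittingIdeal_le_annihilator Module.fittingIdeal
  rw [Ideal.span_le]
  rintro d ⟨n, x, a, hx, ha, rfl⟩
  rw [SetLike.mem_coe, Module.mem_annihilator]
  intro m
  have hle : Submodule.span R (Set.range x) ≤ Submodule.torsionBy R A a.det :=
    Submodule.span_le.mpr (by
      rintro _ ⟨k, rfl⟩
      exact (Submodule.mem_torsionBy_iff _ _).mpr
        (Module.det_smul_eq_zero_of_relations R A x a ha k))
  exact (Submodule.mem_torsionBy_iff _ _).mp (hle (hx ▸ Submodule.mem_top))

/-- **Discharge** of `Module.fittingIdeal_quotient_span_singleton`: `Fitt₀(R ⧸ (r)) = (r)`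
(Eisenbud §20.2, discussion after Cor. 20.4: `Fitt₀(R/I) = I`; Crowell–Fox Ch. VII §4, the `1 × 1`
presentation matrix `(r)`). `⊇`: the generator `1` with relation matrix `(r)` has determinant `r`.
`⊆`: `Fitt₀ ≤ Ann` (`Module.fittingIdeal_le_annihilator_holds`) and `Ann(R ⧸ (r)) = (r)`.
[cite: Eisenbud1995, §20.2 (discussion after Cor. 20.4)] -/
theorem Module.fittingIdeal_quotient_span_singleton_holds :
    Module.fittingIdeal_quotient_span_singleton R := by
  intro r
  apply le_antisymm
  · intro d hd
    have h := Module.mem_annihilator.mp (Module.fittingIdeal_le_annihilator_holds R _ hd)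
      (1 : R ⧸ Ideal.span {r})
    rw [Algebra.smul_def, Ideal.Quotient.algebraMap_eq, mul_one] at h
    exact Ideal.Quotient.eq_zero_iff_mem.mp h
  · rw [Ideal.span_singleton_le_iff_mem, Module.fittingIdeal]
    refine Ideal.subset_span ⟨1, fun _ => 1, Matrix.of fun _ _ => r, ?_, ?_, ?_⟩
    · rw [eq_top_iff]
      rintro m -
      obtain ⟨s, rfl⟩ := Ideal.Quotient.mk_surjective m
      have : Ideal.Quotient.mk (Ideal.span {r}) s = s • (1 : R ⧸ Ideal.span {r}) := by
        rw [Algebra.smul_def, mul_one]; rfl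
      rw [this]
      exact Submodule.smul_mem _ _ (Submodule.subset_span ⟨0, rfl⟩)
    · intro i
      rw [Finset.sum_eq_single (0 : Fin 1) (fun j _ hj => absurd (Subsingleton.elim j 0) hj)
        (fun h => absurd (Finset.mem_univ _) h), Matrix.of_apply, Algebra.smul_def, mul_one]
      exact Ideal.Quotient.eq_zero_iff_mem.mpr (Ideal.mem_span_singleton_self r)
    · rw [Matrix.det_unique, Matrix.of_apply]

end FittingProofs

end Literature.Topology.FourManifolds
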